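import Literature.NumberTheory.EllipticCurves.Rank1Residual.X9NoEntry
import Literature.NumberTheory.EllipticCurves.EmertonPollackWeston2006.MuAnTransferGoodOrdinary
import Literature.NumberTheory.EllipticCurves.YanZhu2026.CyclotomicMainTheoremRational
import Literature.NumberTheory.EllipticCurves.ModPReducibilityProofs
import HarnessLib

/-!
# Class X10b (`ClassX10 W p` with `¬ Surj W 3`): the DISCHARGE INTERFACE at `p = 3`

Print-tier cell `bsd-print-x9` (D-0131 (2), key `x9`), typer seat ty2 — companion of
`X9/LeafDischarge.lean` (class X9, `p ≥ 5`; the two files are import-independent), same conventions: theorems only, no definition, no new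
named fact; every published input is an explicit binder (`hK`, `hGV`, `hEPW`, `hYZ`); the API is
declared as dot-notation extensions `Literature.NumberTheory.EllipticCurves.Rank1Residual.ClassX10.*`
of the census predicate `ClassX10 W p := p = 3 ∧ GoodOrd W 3 ∧ Irr W 3 ∧ (rank clause)`
(`Rank1Residual/Predicates.lean`); the X10b leaf is `Summit.….Rank1Residual.X10.BSDpOnClassX10b :
∀ W p, ClassX10 W p → ¬ Surj W 3 → BSDp W p`, so a prover holds `h : ClassX10 W p` and
`hns : ¬ Surj W 3` and writes `h.goodOrd_three`, `h.kato174_three hK …`, `h.yz49 hYZ …`,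
`h.gv14 hGV …`, `h.zhang14_hyp3_dead_of_not_surj hns`.

Groups as in the X9 file: (1) projections at `3` and in the leaf's own `p`; the prime alone puts
every theorem printed for `p ≥ 5` / `p > 3` off the leaf (`ClassX10.not_five_le`,
`ClassX10.not_three_lt`: BCS 2025 Thm. 1.1.2 / Cor. 1.3.1, EPW Thm. 1 as first typed, W. Zhang 2014,
Jetchev–Skinner–Wan 2017); (2) by-name specialisations at `3`: Kato Thm. 17.4 (1)(2)
(`ClassX10.kato174_three`), Yan–Zhu 2026 Thm. 4.9 — the `p = 3` substitute for BCS (a)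
(`ClassX10.yz49`), GV Prop. (3.7) — a tree theorem (`ClassX10.padicLCoeff_norm_le_one_three`),
GV Thm. (1.4) (`ClassX10.gv14`), EPW Thm. 1 in its odd-prime form (`ClassX10.epw1_odd`);
(3) congruence transport (`ClassX10.not_surj_three_of_torsionIso`, `ClassX10.irr_three_of_torsionIso`);
(4) dead hypotheses beyond `X9SmallImage` / `X9NoEntry` ((Im), (ram), semistability at `3`):
W. Zhang 2014 Thm. 1.4 (3) is unsatisfiable on X10b (`ClassX10.zhang14_hyp3_dead_of_not_surj`).
Nothing is asserted about any curve; X10b keeps its label.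

## References (hypotheses quoted from the tree's fact docstrings, which carry the page locators)

* [Kato2004Asterisque] Thm. 17.4 (p. 273): (1)(2) for `f` good ordinary at `p`; (3) under (12.5.2).
* [YanZhu2024MainConjNonCM] Thm. 4.9 (§4.4 of arXiv:2412.20078v2): `p ≥ 3` good ordinary, `E[p]` irreducible.
* [GreenbergVatsal2000] Thm. (1.4) (§1, odd `p`); Prop. (3.7).
* [EmertonPollackWeston2006] Thm. 1 (p. 2), §1 (p. 5: "we fix an odd prime `p`").
* [WZhang2014] Thm. 1.4 (p. 197) hypotheses (1)–(4); p. 194 (`Ram(ρ̄_{E,p})`).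
* [Serre1972] §2.4 Prop. 15, §5.4 Prop. 21 i).
-/

noncomputable section

open scoped Classical MatrixGroups ModularForm

open CongruenceSubgroup WeierstrassCurve Field Literature.NumberTheory.EllipticCurves
  Literature.NumberTheory.EllipticCurves.ModularForms

namespace Literature.NumberTheory.EllipticCurves.Rank1Residual

/-- Surjectivity of `ρ̄_{E,n}` passes along a `Γ_ℚ`-equivariant `E₁[n] ≃ E₂[n]` — private copy of
`hasSurjectiveModNGaloisRep_of_torsionIso` (`X9/LeafDischarge.lean`), kept here so that the two
interface files do not import each other. [folklore] -/
private theorem surj_of_torsionIso_aux {W₁ W₂ : WeierstrassCurve ℚ} {n : ℤ}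
    (e : geomTorsion W₁ n ≃+ geomTorsion W₂ n)
    (he : ∀ (σ : Field.absoluteGaloisGroup ℚ) (P : geomTorsion W₁ n), e (σ • P) = σ • e P)
    (h : W₁.HasSurjectiveModNGaloisRep n) : W₂.HasSurjectiveModNGaloisRep n := by
  intro ψ
  obtain ⟨σ, hσ⟩ :=
    h (Multiplicative.ofAdd (e.trans ((Multiplicative.toAdd ψ).trans e.symm)))
  refine ⟨σ, Multiplicative.toAdd.injective (AddEquiv.ext fun Q => ?_)⟩
  calc (Multiplicative.toAdd (galoisRepTorsion W₂ n σ)) Q = σ • Q := galoisRepTorsion_apply _ _ _ _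
    _ = σ • e (e.symm Q) := by rw [e.apply_symm_apply]
    _ = e (σ • e.symm Q) := (he σ _).symm
    _ = e ((Multiplicative.toAdd (galoisRepTorsion W₁ n σ)) (e.symm Q)) := by
      rw [galoisRepTorsion_apply]
    _ = e (e.symm ((Multiplicative.toAdd ψ) (e (e.symm Q)))) := by rw [hσ]; rfl
    _ = (Multiplicative.toAdd ψ) Q := by rw [e.apply_symm_apply, e.apply_symm_apply]

/-! ## Class X10b (`ClassX10 W p` with `¬ Surj W 3`): the interface at `p = 3` -/

section X10b

variable {W : WeierstrassCurve ℚ} [W.IsGloballyMinimal] {p : ℕ} [Fact p.Prime]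

/-- X10 ⟹ ord(3) (`GoodOrd W 3`). [folklore] -/
theorem ClassX10.goodOrd_three (h : ClassX10 W p) : GoodOrd W 3 := h.2.1

/-- X10 ⟹ good(3). [folklore] -/
theorem ClassX10.good_three (h : ClassX10 W p) : Good W 3 := h.2.1.1

/-- X10 ⟹ `3 ∤ a_3`. [folklore] -/
theorem ClassX10.not_dvd_frobeniusTrace_three (h : ClassX10 W p) :
    ¬ (3 : ℤ) ∣ W.frobeniusTrace 3 := by
  exact_mod_cast h.2.1.2

/-- X10 ⟹ `IsOrdinaryAt W 3` (ordinarity binder of Kato Thm. 17.4 / GV Prop. 3.7 at `3`). [folklore] -/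
theorem ClassX10.isOrdinaryAt_three (h : ClassX10 W p) : IsOrdinaryAt W 3 :=
  (isOrdinaryAt_iff W 3).mpr h.2.1

/-- X10 ⟹ irr(3). [folklore] -/
theorem ClassX10.irr_three (h : ClassX10 W p) : Irr W 3 := h.2.2.1

/-- X10 ⟹ ¬red(3). [folklore] -/
theorem ClassX10.not_red_three (h : ClassX10 W p) : ¬ Red W 3 := fun hr => hr h.irr_three

/-- X10 ⟹ ord(p) in terms of the leaf's own prime `p` (`= 3`). [folklore] -/
theorem ClassX10.goodOrd (h : ClassX10 W p) : GoodOrd W p := by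
  obtain ⟨rfl, hord, -⟩ := h
  exact hord

/-- X10 ⟹ irr(p) in terms of the leaf's own prime `p` (`= 3`). [folklore] -/
theorem ClassX10.irr (h : ClassX10 W p) : Irr W p := by
  obtain ⟨rfl, -, hirr, -⟩ := h
  exact hirr

/-- X10 ⟹ `IsOrdinaryAt W p` in terms of the leaf's own prime. [folklore] -/
theorem ClassX10.isOrdinaryAt (h : ClassX10 W p) : IsOrdinaryAt W p :=
  (isOrdinaryAt_iff W p).mpr h.goodOrd

/-- X10 ⟹ `p ≠ 2`. [folklore] -/
theorem ClassX10.ne_two (h : ClassX10 W p) : p ≠ 2 := by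
  have := h.1; omega

/-- X10 ⟹ `3 ≤ p` (the "`p ≥ 3`" binder of Yan–Zhu Thm. 4.9). [folklore] -/
theorem ClassX10.three_le (h : ClassX10 W p) : 3 ≤ p := by
  have := h.1; omega

/-- X10 ⟹ `¬ 5 ≤ p`: every cited theorem printed for `p ≥ 5` / `p > 3` (BCS 2025 Thm. 1.1.2 and
Cor. 1.3.1, EPW Thm. 1 as first typed, W. Zhang 2014, Jetchev–Skinner–Wan 2017) is OFF the X10b
leaf by its prime alone. [folklore] -/
theorem ClassX10.not_five_le (h : ClassX10 W p) : ¬ 5 ≤ p := by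
  have := h.1; omega

/-- X10 ⟹ `¬ 3 < p` (BCS Cor. 1.3.1's "`p > 3`" fails). [folklore] -/
theorem ClassX10.not_three_lt (h : ClassX10 W p) : ¬ 3 < p := by
  have := h.1; omega

/-- X10 ⟹ not X9. [folklore] -/
theorem ClassX10.not_classX9 (h : ClassX10 W p) : ¬ ClassX9 W p := fun h' => by
  have := h'.2.2.1; have := h.1; omega

/-- X10 ⟹ ¬mult(3). [folklore] -/
theorem ClassX10.not_mult_three (h : ClassX10 W p) : ¬ Mult W 3 := fun hm =>
  WeierstrassCurve.HasMultiplicativeReduction.not_hasGoodReduction (R := ℤ_[3]) hm h.good_three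

/-- X10b ⟹ `N_E` not square-free in the spelling `W.IsSemistable ℤ` (from
`ClassX10.not_semistable_of_not_surj`, Serre Prop. 21). [cite: Serre1972, §5.4 Prop. 21 i)] -/
theorem ClassX10.not_isSemistable_int_of_not_surj [W.IsElliptic] (h : ClassX10 W p)
    (hns : ¬ Surj W 3) : ¬ W.IsSemistable ℤ :=
  fun hs => ClassX10.not_semistable_of_not_surj W p h hns ((semistable_iff_isSemistable_int W).mpr hs)

/-- **Kato 2004 Thm. 17.4 (1)(2) on X10** (`kato_divisibility W 3`, binder `hK`): torsion and the
`Λ[1/3]`-divisibility at `3`, binders `3 ≠ 2` and `IsOrdinaryAt W 3` discharged. (Clause (3) needs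
`ρ̄_{E,3^n}` onto for all `n`, dead on X10b at `n = 1`.) [cite: Kato2004Asterisque, Thm. 17.4 (1)(2) (p. 273)] -/
theorem ClassX10.kato174_three [W.IsElliptic] {κ : ZpExtension ℚ 3} {γ : Field.absoluteGaloisGroup ℚ}
    {N : ℕ} [NeZero N] {f : CuspForm (Gamma0 N) 2}
    (hK : kato_divisibility W 3 (κ := κ) (γ := γ) (f := f)) (h : ClassX10 W p)
    (hκ : κ.IsCyclotomic) (hγ : κ.IsTopGenerator γ) (hγ' : IsCyclotomicVariable 3 γ)
    (hf : IsNewformOf W f) (D : W.SelmerDualData κ γ) :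
    D.IsTorsion ∧ ∃ (n : ℕ) (g : IwasawaAlgebra 3), g ∈ D.charIdeal ∧
      iwasawaToPowerSeries 3 g =
        PowerSeries.C ((3 : ℚ_[3]) ^ n) * padicLFunction f (unitRoot W 3 : ℚ_[3]) := by
  have hk := hK (by decide) h.isOrdinaryAt_three hκ hγ hγ' hf D
  exact ⟨hk.1, by exact_mod_cast hk.2.1⟩

/-- **Yan–Zhu 2026 Thm. 4.9 (rational cyclotomic main conjecture, `p ≥ 3`) on X10**
(`YanZhu2026.thm49_charIdeal_eq_padicLFunction`, binder `hYZ`, flag `YZ26@3-BF-ERL-Ohta` of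
record travels with it): at every X10 pair, `X(E/ℚ_∞)` is `Λ`-torsion and `char X = (g)` with
`ι g = 3^k · L_3(f, α)`, `k ∈ ℤ` — the `p = 3` substitute for BCS Thm. 1.1.2 (a) (printed for
`p > 3`); binders `3 ≤ 3`, good, `3 ∤ a_3`, irr discharged. [cite: YanZhu2024MainConjNonCM, Thm. 4.9 (§4.4 of arXiv:2412.20078v2; v4 Thm. 5.2)] -/
theorem ClassX10.yz49 [W.IsElliptic] (hYZ : YanZhu2026.thm49_charIdeal_eq_padicLFunction)
    (h : ClassX10 W p) (κ : ZpExtension ℚ 3) (γ : Field.absoluteGaloisGroup ℚ)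
    {N : ℕ} [NeZero N] (f : CuspForm (Gamma0 N) 2)
    (hκ : κ.IsCyclotomic) (hγ : κ.IsTopGenerator γ) (hγ' : IsCyclotomicVariable 3 γ)
    (hf : IsNewformOf W f) (D : W.SelmerDualData κ γ) :
    D.IsTorsion ∧ ∃ (g : IwasawaAlgebra 3) (k : ℤ), D.charIdeal = Ideal.span {g} ∧
      iwasawaToPowerSeries 3 g =
        PowerSeries.C ((3 : ℚ_[3]) ^ k) * padicLFunction f (unitRoot W 3 : ℚ_[3]) := by
  exact_mod_cast hYZ W 3 κ γ f le_rfl h.goodOrd_three.1 h.goodOrd_three.2 h.irr_three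
    hκ hγ hγ' hf D

/-- **GV Prop. (3.7) at `3` on X10 — a tree THEOREM**: every coefficient of `L_3(f, α, T)` is
`3`-integral. [cite: GreenbergVatsal2000, Prop. (3.7)] -/
theorem ClassX10.padicLCoeff_norm_le_one_three [W.IsElliptic] (h : ClassX10 W p)
    {N : ℕ} [NeZero N] {f : CuspForm (Gamma0 N) 2} (hf : IsNewformOf W f) (k : ℕ) :
    ‖padicLCoeff f (unitRoot W 3 : ℚ_[3]) k‖ ≤ 1 :=
  padicLFunction_mem_integral_holds (by decide) h.isOrdinaryAt_three hf h.irr_three k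

omit [W.IsGloballyMinimal] in
/-- **A `3`-congruent partner of an X10b curve is not surjective at `3`.** [folklore] -/
theorem ClassX10.not_surj_three_of_torsionIso (hns : ¬ Surj W 3) {A : WeierstrassCurve ℚ}
    (e : geomTorsion A ((3 : ℕ) : ℤ) ≃+ geomTorsion W ((3 : ℕ) : ℤ))
    (he : ∀ (σ : Field.absoluteGaloisGroup ℚ) (P : geomTorsion A ((3 : ℕ) : ℤ)),
      e (σ • P) = σ • e P) :
    ¬ Surj A 3 :=
  fun hA => hns (surj_of_torsionIso_aux e he hA)

/-- A `3`-congruent partner of an X10 curve has irreducible `A[3]`. [folklore] -/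
theorem ClassX10.irr_three_of_torsionIso (h : ClassX10 W p) {A : WeierstrassCurve ℚ}
    (e : geomTorsion A ((3 : ℕ) : ℤ) ≃+ geomTorsion W ((3 : ℕ) : ℤ))
    (he : ∀ (σ : Field.absoluteGaloisGroup ℚ) (P : geomTorsion A ((3 : ℕ) : ℤ)),
      e (σ • P) = σ • e P) :
    Irr A 3 :=
  GreenbergVatsal2000.hasIrreducibleModPGaloisRep_of_torsionIso e.symm
    (fun σ Q => e.injective (by rw [e.apply_symm_apply, he, e.apply_symm_apply])) h.irr_three

/-- **Greenberg–Vatsal 2000 Thm. (1.4) INTO an X10 pair at `p = 3`** (binder `hGV`; GV is printed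
for every odd `p`): partner `A` good ordinary at `3`, C1 `A[3] ≃ E[3]`, Mazur's main conjecture with
`μ = 0` for `A` ⟹ the same for `E` at `3`. X10-side binders and the partner's irreducibility
discharged. [cite: GreenbergVatsal2000, Thm. (1.4) with Thm. (1.2) (arXiv:math/9906215 p. 5)] -/
theorem ClassX10.gv14 [W.IsElliptic]
    (hGV : GreenbergVatsal2000.thm14_mainConjecture_transfer_of_torsionIso) (h : ClassX10 W p)
    {A : WeierstrassCurve ℚ} [A.IsElliptic] [A.IsGloballyMinimal] (hA : GoodOrd A 3)
    (e : geomTorsion A ((3 : ℕ) : ℤ) ≃+ geomTorsion W ((3 : ℕ) : ℤ))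
    (he : ∀ (σ : Field.absoluteGaloisGroup ℚ) (P : geomTorsion A ((3 : ℕ) : ℤ)),
      e (σ • P) = σ • e P)
    (κ : ZpExtension ℚ 3) (γ : Field.absoluteGaloisGroup ℚ)
    (hκ : κ.IsCyclotomic) (hγ : κ.IsTopGenerator γ) (hγ' : IsCyclotomicVariable 3 γ)
    (hMCA : ∀ [NeZero (A.conductorNorm ℤ)] (fA : CuspForm (Gamma0 (A.conductorNorm ℤ)) 2),
        IsNewformOf A fA → ∀ (ϖA : ℚ), (ϖA : ℝ) * A.realPeriodRat = plusPeriod fA →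
      ∀ (DA : A.SelmerDualData κ γ), DA.IsTorsion ∧
        ∃ gA : IwasawaAlgebra 3, DA.charIdeal = Ideal.span {gA} ∧
          GreenbergVatsal2000.HasUnitContent gA ∧
          iwasawaToPowerSeries 3 gA =
            PowerSeries.C (ϖA : ℚ_[3]) * padicLFunction fA (unitRoot A 3 : ℚ_[3]))
    [NeZero (W.conductorNorm ℤ)] (f : CuspForm (Gamma0 (W.conductorNorm ℤ)) 2)
    (hf : IsNewformOf W f) (ϖ : ℚ) (hϖ : (ϖ : ℝ) * W.realPeriodRat = plusPeriod f)
    (D : W.SelmerDualData κ γ) :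
    D.IsTorsion ∧ ∃ g : IwasawaAlgebra 3, D.charIdeal = Ideal.span {g} ∧
      GreenbergVatsal2000.HasUnitContent g ∧
      iwasawaToPowerSeries 3 g = PowerSeries.C (ϖ : ℚ_[3]) * padicLFunction f (unitRoot W 3 : ℚ_[3]) :=
  hGV A W 3 (by decide) hA.1 hA.2 h.goodOrd_three.1 h.goodOrd_three.2 ⟨e, he⟩
    (h.irr_three_of_torsionIso e he) h.irr_three κ γ hκ hγ hγ' hMCA f hf ϖ hϖ D

/-- **Emerton–Pollack–Weston 2006 Thm. 1 INTO an X10 pair at `p = 3`** — the print-strength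
odd-prime form `thm1_muAn_transfer_of_torsionIso_odd` (binder `hEPW`; the first transcription
asked `5 ≤ p` and is off X10b): partner `A` good ordinary at `3`, C1, the analytic `μ = 0`
certificate for `A` ⟹ analytic `μ = 0` at `(E, 3)`. [cite: EmertonPollackWeston2006, Thm. 1 (arXiv:math/0404484 p. 2), §1 (p. 5, odd p)] -/
theorem ClassX10.epw1_odd [W.IsElliptic]
    (hEPW : EmertonPollackWeston2006.thm1_muAn_transfer_of_torsionIso_odd) (h : ClassX10 W p)
    {A : WeierstrassCurve ℚ} [A.IsElliptic] [A.IsGloballyMinimal] (hA : GoodOrd A 3)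
    (e : geomTorsion A ((3 : ℕ) : ℤ) ≃+ geomTorsion W ((3 : ℕ) : ℤ))
    (he : ∀ (σ : Field.absoluteGaloisGroup ℚ) (P : geomTorsion A ((3 : ℕ) : ℤ)),
      e (σ • P) = σ • e P)
    (hμA : ∀ [NeZero (A.conductorNorm ℤ)] (fA : CuspForm (Gamma0 (A.conductorNorm ℤ)) 2),
        IsNewformOf A fA → ∀ (ϖA : ℚ), (ϖA : ℝ) * A.realPeriodRat = plusPeriod fA →
      ∃ n : ℕ, ‖PowerSeries.coeff n
        (PowerSeries.C (ϖA : ℚ_[3]) * padicLFunction fA (unitRoot A 3 : ℚ_[3]))‖ = 1)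
    [NeZero (W.conductorNorm ℤ)] (f : CuspForm (Gamma0 (W.conductorNorm ℤ)) 2)
    (hf : IsNewformOf W f) (ϖ : ℚ) (hϖ : (ϖ : ℝ) * W.realPeriodRat = plusPeriod f) :
    ∃ n : ℕ, ‖PowerSeries.coeff n
      (PowerSeries.C (ϖ : ℚ_[3]) * padicLFunction f (unitRoot W 3 : ℚ_[3]))‖ = 1 :=
  hEPW A W 3 (by decide) hA.1 hA.2 h.goodOrd_three.1 h.goodOrd_three.2 ⟨e, he⟩
    (h.irr_three_of_torsionIso e he) hμA f hf ϖ hϖ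

/-- **On X10b, `Ram(ρ̄_{E,3}) = ∅` in W. Zhang's spelling** (`ClassX10.not_ram_of_not_surj` for
`ℓ ≠ 3`; `3` is good). [cite: WZhang2014, p. 194 and Thm. 1.4 (3) (p. 197)] -/
theorem ClassX10.zhang14_ram_empty_of_not_surj [W.IsElliptic] (h : ClassX10 W p) (hns : ¬ Surj W 3) :
    ¬ ∃ ℓ : ℕ, ∃ _ : Fact ℓ.Prime, W.HasMultiplicativeReductionAtPrime ℓ ∧
      ¬ 3 ∣ padicValInt ℓ W.minimalDiscriminantInt := by
  rintro ⟨ℓ, hℓ, hmult, hv⟩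
  by_cases hℓ3 : ℓ = 3
  · subst hℓ3
    exact h.not_mult_three hmult
  · exact ClassX10.not_ram_of_not_surj W p h hns ⟨ℓ, hℓ, hℓ3, hmult, hv⟩

/-- **W. Zhang 2014 Thm. 1.4 hypothesis (3) is UNSATISFIABLE on X10b** (besides `p ≥ 5` and
surjectivity failing): `N` is not square-free yet `Ram(ρ̄_{E,3})` is empty.
[cite: WZhang2014, Thm. 1.4 (3) (p. 197)] [cite: Serre1972, §2.4 Prop. 15 and §5.4 Prop. 21 i)] -/
theorem ClassX10.zhang14_hyp3_dead_of_not_surj [W.IsElliptic] (h : ClassX10 W p) (hns : ¬ Surj W 3) :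
    ¬ (¬ W.IsSemistable ℤ →
      (∃ ℓ : ℕ, ∃ _ : Fact ℓ.Prime, W.HasMultiplicativeReductionAtPrime ℓ ∧
          ¬ 3 ∣ padicValInt ℓ W.minimalDiscriminantInt) ∧
        (Set.ncard {ℓ : ℕ | ∃ _ : Fact ℓ.Prime, W.HasMultiplicativeReductionAtPrime ℓ ∧
            ¬ 3 ∣ padicValInt ℓ W.minimalDiscriminantInt} = 1 →
          Even (Set.ncard {ℓ : ℕ | ∃ _ : Fact ℓ.Prime, W.HasMultiplicativeReductionAtPrime ℓ}))) :=
  fun h3 => h.zhang14_ram_empty_of_not_surj hns (h3 (h.not_isSemistable_int_of_not_surj hns)).1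

/-- **X10b discharge ledger** (audit aid): class-level binders available at `3` and image-type
binders refuted. [folklore] -/
theorem ClassX10.discharge_summary_of_not_surj [W.IsElliptic] (h : ClassX10 W p) (hns : ¬ Surj W 3) :
    (p = 3 ∧ W.HasGoodReductionAtPrime 3 ∧ ¬ (3 : ℤ) ∣ W.frobeniusTrace 3 ∧ IsOrdinaryAt W 3 ∧
        W.HasIrreducibleModPGaloisRep 3 ∧ W.analyticRank ≤ 1) ∧
      (¬ Surj W 3 ∧ ¬ BigIm W 3 ∧ ¬ Ram W 3 ∧ ¬ Semistable W ∧ ¬ W.IsSemistable ℤ ∧ ¬ 5 ≤ p) :=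
  ⟨⟨h.1, h.good_three, h.not_dvd_frobeniusTrace_three, h.isOrdinaryAt_three, h.irr_three,
      by rcases h.2.2.2 with ⟨h0, -⟩ | ⟨h1, -⟩ <;> omega⟩,
    ⟨hns, ClassX10.not_bigIm_of_not_surj W p h hns, ClassX10.not_ram_of_not_surj W p h hns,
      ClassX10.not_semistable_of_not_surj W p h hns, h.not_isSemistable_int_of_not_surj hns,
      h.not_five_le⟩⟩

end X10b

end Literature.NumberTheory.EllipticCurves.Rank1Residual
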